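import Summits.QuantumFields.QCD.Theorems.QuarksAsStableActionStableActionBridgeStubCyclicScalarise

/-!
# Stub `stub_cyclicSupertrace_eq_symKernelCycle` of line `pin-the-infimum`
(crux `HeatSlicedQuarks.RobustYangMillsHandover`, item stmt-QuantumFields-8892; wave 2, T2 of M1)

The configuration-space CYCLIC SUPERTRACE of the time-periodic Wilson-quark torus functional
(the integral of the landed capstone `Sketch.integral_fermiBoltzmann_wilsonMeasure_eq_cyclic_supertrace`,
Lüscher's `Z ∝ STr (𝕋P̂₀)^N`),

  `∫∫ ∏_t K_β(U_t, U_{t+1}^{g_t}) · STr ∏_t T̂_F(U_t) Γ(G_{g_t}) dU dg`,  `STr X = Σ_s (−1)^{#s} X_{ss}`,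

IS the graded cyclic path integral `∫ θ(V 0) ∏_{t : Fin N} k_sym(V t, V (t+1)) dν^{⊗N}(V)` over
`X = SU(3)^{E₃} × J` (`ν = Haar ⊗ count`, `J ≃ Finset(modes)` any finite relabelling `e` of the Fock
basis, `θ(U, j) = (−1)^{#e⁻¹j}`) of the gauge-AVERAGED SYMMETRIC kernel
`k_sym((U,s),(U',s')) = ∫ K_β(U, U'^g) [R(U) Γ(G_g) R(U')]_{s s'} dg` built from any continuous graded
(fermion-number preserving) pointwise square root `R(U)² = T̂_F(U)` — the shape consumed by the landed
graded trace formula `stub_gradedCyclicTrace`.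

Proof (pure theorem file, no definitions).  Gradedness `R(U)_{st} = 0` for `#s ≠ #t` gives
`[diag((−1)^{#s}), R(U)] = 0`, so the landed `TwistedTraceTransfer.stub_cyclic_scalarise` (cyclicity of the
Fock trace, `T̂_F = R R`, Fubini, factorisation of the temporal-link integrals over the bonds) rewrites the
left side as the graded cyclic integral of `(R(U) B(U,U') R(U'))_{s s'}`,
`B(U,U')_{ac} = ∫ K_β(U,U'^g) Γ(G_g)_{ac} dg`, over `SU(3)^{E₃} × Finset(modes)`; the constant matrices
`R(U)`, `R(U')` come out of the entrywise `g`-average (`StubCyclicScalarise.integral_mul_three_apply`), and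
the relabelling `s ↦ e s` of the discrete factor is a measure-preserving equivalence of the `N`-fold
product of `Haar ⊗ count` (`measurePreserving_pi`, `MeasurePreserving.prod`, `count ∘ e⁻¹ = count`).

References: M. Lüscher, Commun. Math. Phys. 54 (1977) 283 [Luscher1977, pp. 283–292]; I. Montvay,
G. Münster, *Quantum Fields on a Lattice* [MontvayMunster1994, §4.1.3 (4.34)]; J. Smit, *Introduction to
Quantum Fields on a Lattice* [Smit2023, §4.6 (4.127)–(4.137), §6.5 (6.87)–(6.91)].
-/

noncomputable section

namespace Summit.QuantumFields.QCD.Cruxes.RobustYangMillsHandover.PinTheInfimum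

open MeasureTheory Filter Function Matrix
open Literature.MathematicalPhysics.QuantumFieldTheory Literature.MathematicalPhysics.QuantumLattice
open Literature.Probability.LatticeModels
open Summit.QuantumFields.QCD.Cruxes.StableActionBridge

namespace StubCyclicSymKernel

/-- **Graded matrices commute with every function of the grading**: if `M_{st} = 0` whenever
`c s ≠ c t` then `diag(d ∘ c) M = M diag(d ∘ c)` (entrywise: both sides are `d(c s) M_{st}`
on the blocks and `0` off them). [folklore] -/
theorem diagonal_comp_mul_comm {F γ : Type*} [Fintype F] [DecidableEq F] (c : F → γ) (d : γ → ℂ)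
    (M : Matrix F F ℂ) (hM : ∀ s t, c s ≠ c t → M s t = 0) :
    Matrix.diagonal (fun s => d (c s)) * M = M * Matrix.diagonal (fun s => d (c s)) := by
  ext s t
  rw [Matrix.diagonal_mul, Matrix.mul_diagonal]
  by_cases h : c s = c t
  · rw [h, mul_comm]
  · rw [hM s t h, mul_zero, zero_mul]

/-- A bijection between finite discrete measurable spaces preserves counting measure. [folklore] -/
theorem measurePreserving_count_equiv {F J : Type*} [Fintype F] [MeasurableSpace F]
    [MeasurableSingletonClass F] [Fintype J] [MeasurableSpace J] [MeasurableSingletonClass J]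
    (e : F ≃ J) :
    MeasurePreserving e (Measure.count : Measure F) (Measure.count : Measure J) := by
  refine ⟨measurable_of_countable _, Measure.ext_iff_singleton.2 fun j => ?_⟩
  rw [Measure.map_apply (measurable_of_countable _) (measurableSet_singleton j),
    Measure.count_singleton]
  have hpre : (e : F → J) ⁻¹' {j} = {e.symm j} := by
    ext s
    simp only [Set.mem_preimage, Set.mem_singleton_iff]
    exact ⟨fun h => by rw [← h, Equiv.symm_apply_apply], fun h => by rw [h, Equiv.apply_symm_apply]⟩
  rw [hpre, Measure.count_singleton]

/-- **Relabelling the discrete factor of a cyclic path integral.**  For a finite measure `μ` on `X`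
and a bijection `e : F ≃ J` of finite discrete spaces, the coordinatewise map
`V ↦ (t ↦ ((V t).1, e (V t).2))` transports `(μ ⊗ count_F)^{⊗ι}` to `(μ ⊗ count_J)^{⊗ι}`, so every
integral over `ι → X × J` is the integral of the relabelled integrand over `ι → X × F`. [folklore] -/
theorem integral_pi_prod_count_relabel {ι X F J : Type*} [Fintype ι] [MeasurableSpace X]
    (μ : Measure X) [IsFiniteMeasure μ] [Fintype F] [MeasurableSpace F] [MeasurableSingletonClass F]
    [Fintype J] [MeasurableSpace J] [MeasurableSingletonClass J] (e : F ≃ J)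
    (G : (ι → X × J) → ℂ) :
    ∫ V, G V ∂(Measure.pi fun _ : ι => μ.prod (Measure.count : Measure J)) =
      ∫ W, G (fun t => ((W t).1, e (W t).2))
        ∂(Measure.pi fun _ : ι => μ.prod (Measure.count : Measure F)) := by
  -- the discrete relabelling as a measurable equivalence
  let eM : F ≃ᵐ J :=
    { toEquiv := e
      measurable_toFun := measurable_of_countable _
      measurable_invFun := measurable_of_countable _ }
  let Φ : (ι → X × F) ≃ᵐ (ι → X × J) :=
    MeasurableEquiv.piCongrRight fun _ => MeasurableEquiv.prodCongr (MeasurableEquiv.refl X) eM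
  have heM : MeasurePreserving eM (Measure.count : Measure F) (Measure.count : Measure J) :=
    measurePreserving_count_equiv e
  have hprod : MeasurePreserving (Prod.map id eM) (μ.prod (Measure.count : Measure F))
      (μ.prod (Measure.count : Measure J)) := (MeasurePreserving.id μ).prod heM
  have hΦ : MeasurePreserving Φ (Measure.pi fun _ : ι => μ.prod (Measure.count : Measure F))
      (Measure.pi fun _ : ι => μ.prod (Measure.count : Measure J)) :=
    measurePreserving_pi (fun _ : ι => μ.prod (Measure.count : Measure F))
      (fun _ : ι => μ.prod (Measure.count : Measure J)) fun _ => hprod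
  rw [← hΦ.integral_comp' G]
  rfl

variable {Nf N : ℕ} [NeZero N]

/-- **The symmetric averaged kernel, entrywise**: the constant matrices `R(U)`, `R(U')` come out of the
gauge average, `∫ K_β(U,U'^g) [R(U) Γ(G_g) R(U')]_{ab} dg = [R(U) B(U,U') R(U')]_{ab}` with the averaged
bond kernel `B(U,U')_{ac} = ∫ K_β(U,U'^g) Γ(G_g)_{ac} dg`. [cite: Luscher1977, pp. 283–292] -/
theorem symKernel_entry (β : ℝ)
    (R : GaugeConfig 3 N (Matrix.specialUnitaryGroup (Fin 3) ℂ) →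
      Matrix (Finset (SliceFermiIdx Nf N)) (Finset (SliceFermiIdx Nf N)) ℂ)
    (U U' : GaugeConfig 3 N (Matrix.specialUnitaryGroup (Fin 3) ℂ)) (a b : Finset (SliceFermiIdx Nf N)) :
    ∫ g, (gaugeSliceKernel β U (gaugeTransform g U') : ℂ) *
        (R U * fockGaugeAct (Nf := Nf) (S := N) g * R U') a b
        ∂(Measure.pi fun _ : TorusSite 3 N => haarProbability (Matrix.specialUnitaryGroup (Fin 3) ℂ)) =
      (R U * (Matrix.of fun a c => ∫ g : TorusSite 3 N → Matrix.specialUnitaryGroup (Fin 3) ℂ,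
          (gaugeSliceKernel β U (gaugeTransform g U') : ℂ) * fockGaugeAct (Nf := Nf) g a c
            ∂(Measure.pi fun _ => haarProbability (Matrix.specialUnitaryGroup (Fin 3) ℂ))) * R U') a b :=
  TwistedTraceTransfer.StubCyclicScalarise.integral_mul_three_apply (fockGaugeAct (Nf := Nf))
    (Measure.pi fun _ : TorusSite 3 N => haarProbability (Matrix.specialUnitaryGroup (Fin 3) ℂ))
    TwistedTraceTransfer.StubCyclicScalarise.continuous_fockGaugeAct _
    (TwistedTraceTransfer.StubCyclicScalarise.continuous_kernel₂
      (P := TorusSite 3 N → Matrix.specialUnitaryGroup (Fin 3) ℂ)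
      (gaugeSliceKernel β) (Sketch.continuous_gaugeSliceKernel N β) continuous_const
      (TwistedTraceTransfer.StubCyclicScalarise.continuous_act₂
        (P := TorusSite 3 N → Matrix.specialUnitaryGroup (Fin 3) ℂ)
        gaugeTransform continuous_gaugeTransform_prod continuous_id' continuous_const)) _ _ _ _

end StubCyclicSymKernel

/-- **T2 (M1): the configuration-space cyclic supertrace IS the graded cyclic path integral of the
symmetric averaged kernel.**  For any continuous graded pointwise square root `R(U)² = T̂_F(U)` and any
finite relabelling `e : Finset(modes) ≃ J` of the Fock basis,
`∫∫ ∏_t K_β(U_t, U_{t+1}^{g_t}) · STr ∏_t T̂_F(U_t)Γ(G_{g_t}) dU dg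
   = ∫ (−1)^{#e⁻¹(V 0).2} ∏_{t : Fin N} k_sym(V t, V (t+1)) d(Haar ⊗ count)^{⊗N}(V)`,
`k_sym((U,j),(U',j')) = ∫ K_β(U,U'^g) [R(U)Γ(G_g)R(U')]_{e⁻¹j, e⁻¹j'} dg` (Lüscher's `STr(𝕋P̂₀)^N` in
kernel form; the registered stub signature verbatim). [cite: Luscher1977, pp. 283–292]
[cite: MontvayMunster1994, §4.1.3 (4.34)] [cite: Smit2023, §6.5 (6.87)–(6.91)] -/
theorem stub_cyclicSupertrace_eq_symKernelCycle :
    ∀ (Nf N : ℕ) [NeZero N] (β : ℝ) (mq : Fin Nf → ℝ) (J : Type) [Fintype J] [MeasurableSpace J]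
      [MeasurableSingletonClass J] (e : Finset (SliceFermiIdx Nf N) ≃ J)
      (R : GaugeConfig 3 N (Matrix.specialUnitaryGroup (Fin 3) ℂ) →
        Matrix (Finset (SliceFermiIdx Nf N)) (Finset (SliceFermiIdx Nf N)) ℂ),
      Continuous R → (∀ U, R U * R U = fermionSliceOp U mq) →
      (∀ (U : GaugeConfig 3 N (Matrix.specialUnitaryGroup (Fin 3) ℂ)) (s t : Finset (SliceFermiIdx Nf N)),
        s.card ≠ t.card → R U s t = 0) →
      ∫ p : (ZMod N → GaugeConfig 3 N (Matrix.specialUnitaryGroup (Fin 3) ℂ)) ×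
          (ZMod N → TorusSite 3 N → Matrix.specialUnitaryGroup (Fin 3) ℂ),
        ((∏ t : ZMod N, gaugeSliceKernel β (p.1 t) (gaugeTransform (p.2 t) (p.1 (t + 1))) : ℝ) : ℂ) *
          ∑ s : Finset (SliceFermiIdx Nf N), (-1 : ℂ) ^ s.card *
            (((List.range N).map fun i : ℕ =>
              fermionSliceOp (p.1 (i : ZMod N)) mq * fockGaugeAct (Nf := Nf) (p.2 (i : ZMod N))).prod) s s
        ∂((Measure.pi fun _ : ZMod N => Measure.pi fun _ : Edge 3 N =>
            haarProbability (Matrix.specialUnitaryGroup (Fin 3) ℂ)).prod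
          (Measure.pi fun _ : ZMod N => Measure.pi fun _ : TorusSite 3 N =>
            haarProbability (Matrix.specialUnitaryGroup (Fin 3) ℂ))) =
      ∫ V : Fin N → GaugeConfig 3 N (Matrix.specialUnitaryGroup (Fin 3) ℂ) × J,
        (-1 : ℂ) ^ (e.symm (V 0).2).card *
          ∏ t : Fin N, (fun (p q : GaugeConfig 3 N (Matrix.specialUnitaryGroup (Fin 3) ℂ) × J) =>
            ∫ g, (gaugeSliceKernel β p.1 (gaugeTransform g q.1) : ℂ) *
              (R p.1 * fockGaugeAct (Nf := Nf) (S := N) g * R q.1) (e.symm p.2) (e.symm q.2)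
            ∂(Measure.pi fun _ : TorusSite 3 N => haarProbability (Matrix.specialUnitaryGroup (Fin 3) ℂ)))
            (V t) (V (t + 1))
        ∂(Measure.pi fun _ : Fin N => (sliceHaar N).prod (Measure.count : Measure J)) := by
  intro Nf N _ β mq J _ _ _ e R hRc hR2 hgr
  classical
  -- gradedness ⇒ `R(U)` commutes with the fermion parity
  have hP : ∀ U, Matrix.diagonal (fun s : Finset (SliceFermiIdx Nf N) => (-1 : ℂ) ^ s.card) * R U =
      R U * Matrix.diagonal (fun s : Finset (SliceFermiIdx Nf N) => (-1 : ℂ) ^ s.card) := fun U =>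
    StubCyclicSymKernel.diagonal_comp_mul_comm Finset.card (fun k : ℕ => (-1 : ℂ) ^ k) (R U) (hgr U)
  -- the landed scalarisation of the supertrace side
  rw [(TwistedTraceTransfer.stub_cyclic_scalarise Nf N β mq R hRc hR2 hP).2]
  -- the constant matrices come out of the gauge average
  simp only [StubCyclicSymKernel.symKernel_entry]
  -- relabel the discrete factor along `e`
  haveI : IsProbabilityMeasure (sliceHaar (S := N)) := by unfold sliceHaar; infer_instance
  rw [StubCyclicSymKernel.integral_pi_prod_count_relabel (sliceHaar N) e]
  simp only [Equiv.symm_apply_apply]
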